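import Summits.BirchSwinnertonDyer.BirchSwinnertonDyer.Theorems.KatoDescentPotSupersingularReducibleFineSelmerDescentCountSharp
import Summits.BirchSwinnertonDyer.BirchSwinnertonDyer.Theorems.KatoDescentPotSupersingularTowerTorsionVanishing
import Literature.NumberTheory.EllipticCurves.Kato2004.IwasawaH2FineSelmerDualComparison
import Literature.NumberTheory.EllipticCurves.Kato2004.IwasawaH2DescentRankOne
import HarnessLib

/-!
# KATO'S THM. 14.5 (3) AT LEVEL `0` ON THE TAME REDUCIBLE ROWS, WITHOUT THE MEMBER PACKAGE AND WITHOUT A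
# `𝐇²`-PIN: `#Sel_str(ℚ, W[p^∞]) ∣ [H¹(ℤ[1/p], T_pW) : ℤ_p·𝐲₀]` modulo six atomic named facts
# {H2X, Z0, 13.4, Serre, FW, Lim 3.5} — the `J`-road descends (crux M 19196)

Seat `bsd-potss-rkm` g28 (prover, cell `bsd-potss`), item stmt-BirchSwinnertonDyer-19196 `ReducibleKatoMember` =
crux M of K9 `KatoDescentPotSupersingular` (support) / K8-t′ `KatoDescentTamePotSupersingular` (auto-crux);
`--supports … --as helper`; route-free; closes nothing.  HONEST FRAMING: BSD is not proved by any of this;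
nothing is booked; crux M stays cite-level on {modularity, HELD 27962 `Kato2004.exists_memberHullZetaCoreInputs`};
theorems only (no definition, no named fact, no `sorry`).

## What and why

Kato, Astérisque 295, Thm. 14.5 (3) (p. 236): "Assume `p ≠ 2` … Then we have
`#(H²(ℤ[1/p],T)) ≤ [H¹(ℤ[1/p],T) : z]`."  His §14.14 proof: (14.14.1)
`0 → 𝐇¹(T)/a𝐇¹(T) → H¹(ℤ[1/p],T) → ₐ𝐇²(T) → 0`, (14.14.2) `𝐇²(T)/a𝐇²(T) ≅ H²(ℤ[1/p],T)`, and Lemma 14.15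
(`#(𝐇²/a) ≤ #ₐ𝐇² · [𝐇¹/a : z̄]` from `char 𝐇² ∣ char(𝐇¹/z)`).  The tree has no `𝐇²(T)` object; the rkm
lineage proved the FINE-SELMER shadow (g15 `char X₀ ∣ char(𝐇¹_Γ/Λ𝐲)` modulo {13.4, Serre, FW, Lim}; g16
`#Sel₀(ℚ_∞)^Γ · #(H¹(ℤ[1/p],T)/proj₀(𝐇¹_Γ/T)) ∣ #Sel₀(ℚ_∞)_Γ · [H¹(ℤ[1/p],T) : ℤ_p 𝐲₀]`, file
`…ReducibleFineSelmerDescentCountSharp`) and the exact control `#Sel_str(ℚ,W[p^∞]) = #Sel₀(ℚ_∞)^Γ` on the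
rows with `W(ℚ_p)[p] = 0` (g27 `…ExactFineControl{,Rows}`), leaving the factor `#Sel₀(ℚ_∞)_Γ = #X₀[T]`
unaccounted ("the `X₀`-road is lossy": on Kato's objects `X₀[T] ⊆ 𝐇²[T]`).

THIS FILE removes that factor with the EXISTING named fact H2X
(`Kato2004.exists_iwasawaH2Data_fineSelmerDual_embedding`, bsd-cm p624791: Kato's `𝐇²_Γ(T_pW)` with its
(14.14.1) on the pinned pair `(𝐇¹_Γ, H¹(ℤ[1/p],T_pW))` CONTAINS `X₀(W/ℚ_∞)`; its finiteness hypothesis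
`W(ℚ_{p,∞})[p^∞]` finite is a tree theorem on the rows with `W(ℚ_p)[p] = 0`, g26 `…TowerTorsionVanishing`):
for ANY descent package `J : IwasawaH2Data W p κ γ I` and ANY injective `Λ`-linear `X₀ → J.H2`,

  `X₀[T] ↪ J.H2[T] ≅ H¹(ℤ[1/p],T_pW)/proj₀(𝐇¹_Γ/T)`   (`IwasawaH2Data.descentCokernelEquiv`, J's own exactness),

so `#Sel₀(ℚ_∞)_Γ = #X₀[T]` DIVIDES `#(H¹(ℤ[1/p],T_pW)/proj₀(𝐇¹_Γ/T))` (§1, unconditional algebra on a package)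
and cancels from g16's sharp divisibility (§2):

* §1 `natCard_invariants_dvd_natCard_descentCokernel`, `natCard_fineSelmer_coinvariants_dvd_natCard_descentCokernel`;
* §2 **`natCard_fineSelmer_invariants_dvd_index_of_embedding`** — reducible non-CM rank-0 row, genuine Euler-system
  class `s` with `proj₀ s` of infinite order, `J` + injective `X₀ → J.H2` ⟹ `#Sel₀(ℚ_∞)^Γ ∣ [H¹(ℤ[1/p],T_pW) : ℤ_p s₀]`;
* §3 **`exists_zetaLift_natCard_fineSelmer_invariants_dvd_index_of_H2X`** — the `∃`-form over the six facts
  {H2X, Z0, 13.4, Serre, FW, Lim 3.5} (hypothesis: `W(ℚ_{p,∞})[p^∞]` finite), `…_of_noPTorsionPadic`; and the consumable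
  form ON THE LIFT of a value-guarded `ZetaBody` family, `natCard_fineSelmer_invariants_dvd_index_zetaLift_of_H2X` (the binder
  `∀ n, proj n 𝐲 = levelToLayer … (z (n+1) …)` under which the held package 27962 speaks of `𝐲`);
* SEQUEL `…ReducibleH2DescentCountStrict` (same namespace) — with g27's exact control:
  **`#Sel_str(ℚ, W[p^∞]) ∣ [H¹(ℤ[1/p], T_pW) : ℤ_p·𝐲₀]`** (Kato's strict group `katoStrictSelmer W p {v_p}` of
  (14.9.3) = `#H²(ℤ[1/p],T_pW)` on these rows by (14.14.2) + (14.9.3)), rows `…_of_addv_of_eleven_le` (EVERY additive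
  `p ≥ 11`: all (t′) rows of K8-t′), `…_of_addv` (`p ≥ 5` off Kodaira II/III).

WHAT THIS IS / IS NOT.  It is Kato Thm. 14.5 (3) at level `0` on the tame reducible non-CM rank-0 rows of crux M,
for the `(c,d)`-zeta class `𝐲` (a genuine Euler-system class with `𝐲₀` of infinite order FROM THE VALUE), with
Thm. 13.4 + Serre in place of (12.5.1), read through the fine Selmer group — modulo six ATOMIC named facts and NO
`∃`-package of crux M (neither 27962 nor any `MemberHull…Inputs`), and with no abstract-`𝐇²` clause left in the
statement.  It is NOT crux M: the local index of `𝐲₀` at `p` ((b′): Lemma 14.18 / Kim §3.2.3 with the VALUE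
Thm. 12.5 (1)) and the Poitou–Tate ledger to `Ш`/Tamagawa (kernel, g17–g20) are not touched here; and the count is
ONE-SIDED (the equality `#X₀[T] = #𝐇²_Γ[T]` on tame rows would need the cokernel of `X₀ ↪ 𝐇²_Γ` INSIDE
`(W(ℚ_{p,∞})[p^∞])^∨`, which H2X forgets).

References: K. Kato, Astérisque 295 (2004), Thm. 12.4 (p. 221), Thm. 13.4 (p. 226), Thm. 14.5 (p. 236), (14.9.1)–(14.9.3)
(pp. 239–240), §14.14 (14.14.1)–(14.14.2) and Lemma 14.15 (pp. 243–244) [Kato2004Asterisque]; R. Greenberg, LNM 1716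
(1999) §3 Prop. 3.8, §4 Lemma 4.2 [GreenbergLNM1716]; C. Wuthrich, Doc. Math. 19 (2014) Lemma 14 [Wuthrich2014].
-/

-- the summit and its single problem are both named `BirchSwinnertonDyer` (registry layout D-0017)
set_option linter.dupNamespace false
set_option autoImplicit false

noncomputable section

open scoped Classical NumberField TensorProduct
open Function Field NumberField IsDedekindDomain WeierstrassCurve CongruenceSubgroup
open Literature.NumberTheory.EllipticCurves Literature.NumberTheory.EllipticCurves.GreenbergSelmer
open Literature.NumberTheory.GaloisRepresentations
open Literature.NumberTheory.EllipticCurves.ModularForms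
open Literature.NumberTheory.EllipticCurves.Kato2004 Literature.NumberTheory.EllipticCurves.Kato2004.EulerSystemValues
open Literature.NumberTheory.EllipticCurves.IwasawaAlgebra Literature.NumberTheory.EllipticCurves.IwasawaDual
open Literature.NumberTheory.EllipticCurves.Rank1Residual
open Summit.BirchSwinnertonDyer.Rank1Residual
open Summit.BirchSwinnertonDyer.BirchSwinnertonDyer.Theorems

namespace Summit.BirchSwinnertonDyer.BirchSwinnertonDyer.Theorems.ReducibleH2DescentCount

/-! ## §1 On a descent package: `X[T] ↪ J.H2[T] ≅ H¹(ℤ[1/p],T_pW)/proj₀(𝐇¹_Γ/T)` -/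

section Package

variable {W : WeierstrassCurve ℚ} [W.IsElliptic] {p : ℕ} [Fact p.Prime]
  [ContinuousSMul ℤ_[p] (W.tateModule p)] {κ : ZpExtension ℚ p} {γ : absoluteGaloisGroup ℚ}
  {I : IwasawaH1Data W p κ γ}

/-- **`#X[T] ∣ #(H¹(ℤ[1/p],T_pW)/proj₀(𝐇¹_Γ/T))` for every `Λ`-module `X` embedded in the `𝐇²` of a descent
package.**  For `J : IwasawaH2Data W p κ γ I` (Kato's `𝐇²_Γ(T_pW)` with (14.14.1) pinned to `proj₀`) and an
injective `Λ`-linear `e : X → J.H2`: `X[T] ↪ J.H2[T]` (`invariantsMap`), and `J.H2[T] ≅ descentCokernel I =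
H¹(ℤ[1/p],T_pW)/proj₀(𝐇¹_Γ/T)` by the exactness of (14.14.1) (`IwasawaH2Data.descentCokernelEquiv`); Lagrange.
Unconditional algebra on a package (`Nat.card`, no finiteness assumed).
[cite: Kato2004Asterisque, §14.14 (14.14.1) (p. 243)] -/
theorem natCard_invariants_dvd_natCard_descentCokernel (J : IwasawaH2Data W p κ γ I)
    {X : Type*} [AddCommGroup X] [Module (IwasawaAlgebra p) X]
    (e : X →ₗ[IwasawaAlgebra p] J.H2) (he : Injective e) :
    Nat.card (invariants p X) ∣ Nat.card I.descentCokernel := by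
  rw [Nat.card_congr J.descentCokernelEquiv.toEquiv]
  exact AddSubgroup.card_dvd_of_injective (invariantsMap e).toAddMonoidHom (invariantsMap_injective e he)

/-- **`#Sel₀(W/ℚ_∞)_Γ ∣ #(H¹(ℤ[1/p],T_pW)/proj₀(𝐇¹_Γ/T))`** as soon as some dual fine Selmer datum `Y` embeds
`Λ`-linearly into the `𝐇²` of a descent package (`#Y.X[T] = #Sel₀(ℚ_∞)_Γ`, `FineSelmerDualData.isDualPair` /
`IsDualPair.natCard_invariants`; `Γ`-coinvariants of `Sel₀(ℚ_∞, W[p^∞])` = `EndCoinvariants (conj_γ − 1)`).  On Kato's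
objects this is `X₀(W/ℚ_∞)[T] ⊆ 𝐇²_Γ(T_pW)[T]` (Poitou–Tate along the tower, (14.9.1)).
[cite: Kato2004Asterisque, (14.9.1) (p. 239) and §14.14 (14.14.1) (p. 243)] [cite: GreenbergLNM1716, §1 (after Conj. 1.3)] -/
theorem natCard_fineSelmer_coinvariants_dvd_natCard_descentCokernel (hγ : κ.IsTopGenerator γ)
    (J : IwasawaH2Data W p κ γ I) (Y : W.FineSelmerDualData κ γ)
    (e : Y.X →ₗ[IwasawaAlgebra p] J.H2) (he : Injective e) :
    Nat.card (EndCoinvariants (W.conjFineSelmerInfty κ γ - 1)) ∣ Nat.card I.descentCokernel := by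
  rw [← (Y.isDualPair hγ).natCard_invariants]
  exact natCard_invariants_dvd_natCard_descentCokernel J e he

/-- Arithmetic of the cancellation: `a·d ∣ b·c`, `b ∣ d`, `b ≠ 0` ⟹ `a ∣ c`. [folklore] -/
theorem dvd_of_mul_dvd_mul_of_dvd {a b c d : ℕ} (h : a * d ∣ b * c) (hbd : b ∣ d) (hb : b ≠ 0) : a ∣ c := by
  obtain ⟨t, rfl⟩ := hbd
  have h' : b * (a * t) ∣ b * c := by rwa [mul_left_comm] at h
  exact (dvd_mul_right a t).trans ((Nat.mul_dvd_mul_iff_left (Nat.pos_of_ne_zero hb)).mp h')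

end Package

/-! ## §2 Reducible non-CM rank-0 rows: `#Sel₀(W/ℚ_∞)^Γ ∣ [H¹(ℤ[1/p],T_pW) : ℤ_p·s₀]` given a package and an embedding -/

section Reducible

variable (W : WeierstrassCurve ℚ) [W.IsElliptic] (p : ℕ) [Fact p.Prime]
  [ContinuousSMul ℤ_[p] (W.tateModule p)] [Module.Free ℤ_[p] (W.tateModule p)]
  [Module.Finite ℤ_[p] (W.tateModule p)]
  [Finite W.toAffine.Point] [Finite (AddCommGroup.primaryComponent W.sha p)]
  {κ : ZpExtension ℚ p} {γ : absoluteGaloisGroup ℚ}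

/-- **Kato Thm. 14.5 (3) on the fine road at level `0`, the `X₀[T]`-factor CANCELLED.**  `W/ℚ` non-CM, `p ≠ 2`,
`W[p]` reducible, `W(ℚ)` and `Ш(W)[p^∞]` finite, `(κ, γ)` cyclotomic, `I` the pinned `𝐇¹_Γ(T_pW)`; `J : IwasawaH2Data W p κ γ I`
a descent package with an injective `Λ`-linear map from some dual fine Selmer datum `Y.X = X₀(W/ℚ_∞)` into `J.H2`; `s` a
genuine Λ-adic Euler-system class with `proj₀ s` of infinite order.  Then `Sel₀(ℚ_∞,W[p^∞])^Γ` and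
`H¹(ℤ[1/p],T_pW)/ℤ_p s₀` are finite and **`#Sel₀(ℚ_∞, W[p^∞])^Γ ∣ [H¹(ℤ[1/p], T_pW) : ℤ_p·s₀]`** — g16's sharp
divisibility `#Sel₀^Γ · #(H¹/proj₀(𝐇¹_Γ/T)) ∣ #(Sel₀)_Γ · [H¹ : ℤ_p s₀]` (`char X₀ ∣ char(𝐇¹_Γ/Λs)`, Kato 13.4 via Serre,
μ = 0 via FW + Lim, Greenberg L.4.2) with `#(Sel₀)_Γ ∣ #(H¹/proj₀(𝐇¹_Γ/T))` (§1) cancelled.  Modulo the four named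
facts in the binders. [cite: Kato2004Asterisque, Thm. 13.4 (p. 226), Thm. 14.5 (3) (p. 236), §14.14 (14.14.1) and Lemma 14.15 (pp. 243–244)]
[cite: GreenbergLNM1716, §4 Lemma 4.2 (p. 102)] [cite: Wuthrich2014, Lemma 14 (p. 396)] -/
theorem natCard_fineSelmer_invariants_dvd_index_of_embedding
    (h134 : thm13_4_lengthAt_fineSelmerDual_le_of_isEulerSystemClass)
    (hSerre : serre_adicImage_contains_congruenceSubgroup)
    (hLim : Lim2017.thm35_fineSelmerDual_moduleFinite_of_classicalMuVanishes_of_le_divisionField)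
    (hFW : Literature.NumberTheory.IwasawaTheory.ferreroWashington1979_classicalMuVanishes)
    (hp : p ≠ 2) (hκ : κ.IsCyclotomic) (hγ : κ.IsTopGenerator γ) (hCM : ¬ W.HasCM)
    (hred : ¬ W.HasIrreducibleModPGaloisRep p) (I : IwasawaH1Data W p κ γ)
    (J : IwasawaH2Data W p κ γ I) (Y : W.FineSelmerDualData κ γ)
    (e : Y.X →ₗ[IwasawaAlgebra p] J.H2) (he : Injective e)
    (s : I.H) (hs : IsEulerSystemClass W p κ γ I s) (hnt : ¬ IsOfFinAddOrder (I.proj 0 s)) :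
    Finite (endInvariants (W.conjFineSelmerInfty κ γ - 1)) ∧
      Finite (integralH1 (tateRep W p) p (κ.layerSubgroup 0) ⧸
        Submodule.span ℤ_[p] {(⟨I.proj 0 s, I.proj_mem 0 s⟩ : integralH1 (tateRep W p) p (κ.layerSubgroup 0))}) ∧
      Nat.card (endInvariants (W.conjFineSelmerInfty κ γ - 1)) ∣
        Nat.card (integralH1 (tateRep W p) p (κ.layerSubgroup 0) ⧸
          Submodule.span ℤ_[p] {(⟨I.proj 0 s, I.proj_mem 0 s⟩ :
            integralH1 (tateRep W p) p (κ.layerSubgroup 0))}) := by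
  obtain ⟨h1, h2, -, h4, h5⟩ :=
    ReducibleFineSelmerDescentCount.natCard_fineSelmer_invariants_mul_descentCokernel_dvd_of_isEulerSystemClass_of_not_irreducible
      W p h134 hSerre hLim hFW hp hκ hγ hCM hred I Y s hs hnt
  haveI := h2
  exact ⟨h1, h4, dvd_of_mul_dvd_mul_of_dvd h5
    (natCard_fineSelmer_coinvariants_dvd_natCard_descentCokernel hγ J Y e he) Nat.card_pos.ne'⟩

end Reducible

/-! ## §3 The `∃`-form over the six atomic facts {H2X, Z0, 13.4, Serre, FW, Lim 3.5} -/

section Exists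

variable (W : WeierstrassCurve ℚ) [W.IsElliptic] (p : ℕ) [Fact p.Prime]
  [ContinuousSMul ℤ_[p] (W.tateModule p)] [Module.Free ℤ_[p] (W.tateModule p)]
  [Module.Finite ℤ_[p] (W.tateModule p)]
  [Finite W.toAffine.Point] [Finite (AddCommGroup.primaryComponent W.sha p)]
  {κ : ZpExtension ℚ p} {γ : absoluteGaloisGroup ℚ}

/-- **Kato Thm. 14.5 (3) on the fine road at level `0` for Kato's own zeta class, from ATOMIC facts.**  On a reducible
non-CM rank-0 row (`W` non-CM, `p ≠ 2`, `W[p]` reducible, `W(ℚ)` and `Ш(W)[p^∞]` finite, `L(W,1) ≠ 0`, `f` the newform of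
`W`), for the cyclotomic `(κ, γ)`, the place `v ∣ p` with `W(ℚ_{p,∞})[p^∞]` finite, and EVERY pin `I : IwasawaH1Data W p κ γ`:
there is a non-zero genuine Λ-adic Euler-system class `𝐲 ∈ 𝐇¹_Γ(T_pW)` (the lift of Kato's `(c,d,a(A))`-zeta family of `f`
for an admissible datum) with `𝐲₀ = proj₀ 𝐲` of infinite order, `Sel₀(ℚ_∞,W[p^∞])^Γ` and `H¹(ℤ[1/p],T_pW)/ℤ_p 𝐲₀` finite,
and **`#Sel₀(ℚ_∞, W[p^∞])^Γ ∣ [H¹(ℤ[1/p], T_pW) : ℤ_p·𝐲₀]`** — modulo {H2X `exists_iwasawaH2Data_fineSelmerDual_embedding`,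
Z0 `exists_member_eulerSystem_expStar_values`, Kato 13.4, Serre, FW, Lim 3.5} and nothing else.
[cite: Kato2004Asterisque, Thm. 12.5 (p. 221), Thm. 13.4 (p. 226), Thm. 14.5 (2)–(3) (p. 236), (14.9.1) (p. 239), §14.14 (pp. 243–244)]
[cite: GreenbergLNM1716, §4 Lemma 4.2 (p. 102)] [cite: Wuthrich2014, Lemma 14 (p. 396)] -/
theorem exists_zetaLift_natCard_fineSelmer_invariants_dvd_index_of_H2X
    (hX : exists_iwasawaH2Data_fineSelmerDual_embedding)
    (hZ0 : exists_member_eulerSystem_expStar_values)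
    (h134 : thm13_4_lengthAt_fineSelmerDual_le_of_isEulerSystemClass)
    (hSerre : serre_adicImage_contains_congruenceSubgroup)
    (hLim : Lim2017.thm35_fineSelmerDual_moduleFinite_of_classicalMuVanishes_of_le_divisionField)
    (hFW : Literature.NumberTheory.IwasawaTheory.ferreroWashington1979_classicalMuVanishes)
    (hp : p ≠ 2) (hκ : κ.IsCyclotomic) (hγ : κ.IsTopGenerator γ) (hCM : ¬ W.HasCM)
    (hred : ¬ W.HasIrreducibleModPGaloisRep p)
    (v : HeightOneSpectrum (𝓞 ℚ)) (hv : ((Rat.HeightOneSpectrum.primesEquiv v : Nat.Primes) : ℕ) = p)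
    (hfin : Finite (FixedPoints.addSubgroup ↥(κ.kerSubgroup ⊓ decomp v) (W.geomPrimaryTorsion p)))
    (I : IwasawaH1Data W p κ γ) {N : ℕ} [NeZero N] (f : CuspForm (Gamma0 N) 2) (hf : IsNewformOf W f)
    (hL1 : W.entireLFunction 1 ≠ 0) (ι : (m : ℕ) → (CyclotomicField m ℚ →+* ℂ)) :
    ∃ y : I.H, y ≠ 0 ∧ IsEulerSystemClass W p κ γ I y ∧ ¬ IsOfFinAddOrder (I.proj 0 y) ∧
      Finite (endInvariants (W.conjFineSelmerInfty κ γ - 1)) ∧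
      Finite (integralH1 (tateRep W p) p (κ.layerSubgroup 0) ⧸
        Submodule.span ℤ_[p] {(⟨I.proj 0 y, I.proj_mem 0 y⟩ : integralH1 (tateRep W p) p (κ.layerSubgroup 0))}) ∧
      Nat.card (endInvariants (W.conjFineSelmerInfty κ γ - 1)) ∣
        Nat.card (integralH1 (tateRep W p) p (κ.layerSubgroup 0) ⧸
          Submodule.span ℤ_[p] {(⟨I.proj 0 y, I.proj_mem 0 y⟩ :
            integralH1 (tateRep W p) p (κ.layerSubgroup 0))}) := by
  -- Kato's `𝐇² ⊇ X₀` package (the named fact H2X, hypothesis `hfin`), on THE constructed datum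
  obtain ⟨J, e, he, -⟩ := hX W p κ γ hγ v hp hκ hv hfin I
  -- Kato's zeta class with `𝐲₀` of infinite order (seat g16, over Z0)
  obtain ⟨y, hy0, hES, hnt, -⟩ :=
    ReducibleFineSelmerDescentCount.exists_zetaLift_natCard_fineSelmer_invariants_dvd_index W p hZ0 h134 hSerre hLim
      hFW hp hκ hγ hCM hred I (W.fineSelmerDualData κ hγ) f hf hL1 ι
  exact ⟨y, hy0, hES, hnt, natCard_fineSelmer_invariants_dvd_index_of_embedding W p h134 hSerre hLim hFW hp hκ hγ hCM
    hred I J (W.fineSelmerDualData κ hγ) e he y hES hnt⟩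

/-- **The same with the local hypothesis `W(ℚ_p)[p] = 0` displayed** (then `W(ℚ_{p,∞})[p^∞] = 0`,
`TowerTorsionVanishing.finite_fixedPoints_kerSubgroup_inf_decomp_of_noPTorsionPadic`).
[cite: Kato2004Asterisque, Thm. 14.5 (3) (p. 236), (14.9.1) (p. 239), §14.14 (pp. 243–244)] [cite: GreenbergLNM1716, §3 Lemma 3.1, §4 Lemma 4.2] -/
theorem exists_zetaLift_natCard_fineSelmer_invariants_dvd_index_of_noPTorsionPadic
    (hX : exists_iwasawaH2Data_fineSelmerDual_embedding)
    (hZ0 : exists_member_eulerSystem_expStar_values)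
    (h134 : thm13_4_lengthAt_fineSelmerDual_le_of_isEulerSystemClass)
    (hSerre : serre_adicImage_contains_congruenceSubgroup)
    (hLim : Lim2017.thm35_fineSelmerDual_moduleFinite_of_classicalMuVanishes_of_le_divisionField)
    (hFW : Literature.NumberTheory.IwasawaTheory.ferreroWashington1979_classicalMuVanishes)
    (hp : p ≠ 2) (hκ : κ.IsCyclotomic) (hγ : κ.IsTopGenerator γ) (hCM : ¬ W.HasCM)
    (hred : ¬ W.HasIrreducibleModPGaloisRep p)
    (h4 : ∀ R : (W.baseChange ℚ_[p]).toAffine.Point, p • R = 0 → R = 0)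
    (I : IwasawaH1Data W p κ γ) {N : ℕ} [NeZero N] (f : CuspForm (Gamma0 N) 2) (hf : IsNewformOf W f)
    (hL1 : W.entireLFunction 1 ≠ 0) (ι : (m : ℕ) → (CyclotomicField m ℚ →+* ℂ)) :
    ∃ y : I.H, y ≠ 0 ∧ IsEulerSystemClass W p κ γ I y ∧ ¬ IsOfFinAddOrder (I.proj 0 y) ∧
      Finite (endInvariants (W.conjFineSelmerInfty κ γ - 1)) ∧
      Finite (integralH1 (tateRep W p) p (κ.layerSubgroup 0) ⧸
        Submodule.span ℤ_[p] {(⟨I.proj 0 y, I.proj_mem 0 y⟩ : integralH1 (tateRep W p) p (κ.layerSubgroup 0))}) ∧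
      Nat.card (endInvariants (W.conjFineSelmerInfty κ γ - 1)) ∣
        Nat.card (integralH1 (tateRep W p) p (κ.layerSubgroup 0) ⧸
          Submodule.span ℤ_[p] {(⟨I.proj 0 y, I.proj_mem 0 y⟩ :
            integralH1 (tateRep W p) p (κ.layerSubgroup 0))}) :=
  exists_zetaLift_natCard_fineSelmer_invariants_dvd_index_of_H2X W p hX hZ0 h134 hSerre hLim hFW hp hκ hγ hCM hred
    (primePlace p) (coe_primesEquiv_primePlace p)
    (TowerTorsionVanishing.finite_fixedPoints_kerSubgroup_inf_decomp_of_noPTorsionPadic W p κ (primePlace p)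
      (coe_primesEquiv_primePlace p) h4) I f hf hL1 ι

/-- **The consumable form ON THE LIFT: for a value-guarded `ZetaBody` family and ITS Λ-adic lift `𝐲`** (the same binder
`∀ n, proj n 𝐲 = levelToLayer … (z (n+1) …)` under which the held package 27962 speaks of `𝐲`), on a reducible non-CM rank-0 row with
`W(ℚ_{p,∞})[p^∞]` finite: **`#Sel₀(ℚ_∞, W[p^∞])^Γ ∣ [H¹(ℤ[1/p], T_pW) : ℤ_p·𝐲₀]`**, both finite — modulo {H2X, 13.4, Serre, FW, Lim 3.5}
(`𝐲` is a genuine Euler-system class, `isEulerSystemClass_of_zetaBody`; `𝐲₀` has infinite order from the VALUE,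
`MemberIndexOfValue.not_isOfFinAddOrder_proj_zero_of_zetaBody`). [cite: Kato2004Asterisque, Thm. 12.5 (p. 221), Thm. 14.5 (2)–(3) (p. 236), (14.9.1) (p. 239), §14.14 (pp. 243–244)]
[cite: GreenbergLNM1716, §4 Lemma 4.2 (p. 102)] -/
theorem natCard_fineSelmer_invariants_dvd_index_zetaLift_of_H2X
    (hX : exists_iwasawaH2Data_fineSelmerDual_embedding)
    (h134 : thm13_4_lengthAt_fineSelmerDual_le_of_isEulerSystemClass)
    (hSerre : serre_adicImage_contains_congruenceSubgroup)
    (hLim : Lim2017.thm35_fineSelmerDual_moduleFinite_of_classicalMuVanishes_of_le_divisionField)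
    (hFW : Literature.NumberTheory.IwasawaTheory.ferreroWashington1979_classicalMuVanishes)
    (hp : p ≠ 2) (hκ : κ.IsCyclotomic) (hγ : κ.IsTopGenerator γ) (hCM : ¬ W.HasCM)
    (hred : ¬ W.HasIrreducibleModPGaloisRep p)
    (v : HeightOneSpectrum (𝓞 ℚ)) (hv : ((Rat.HeightOneSpectrum.primesEquiv v : Nat.Primes) : ℕ) = p)
    (hfin : Finite (FixedPoints.addSubgroup ↥(κ.kerSubgroup ⊓ decomp v) (W.geomPrimaryTorsion p)))
    (I : IwasawaH1Data W p κ γ) {N : ℕ} [NeZero N] {f : CuspForm (Gamma0 N) 2}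
    {ι : (m : ℕ) → (CyclotomicField m ℚ →+* ℂ)} {κ' : ℝ}
    {Λ' : ∀ (k : ℕ) (r : Finset (HeightOneSpectrum (𝓞 ℚ))),
      H1 (tateRep W p) (cycSubgroup p k r) →ₗ[ℤ_[p]] ℚ_[p] ⊗[ℚ] CyclotomicField (cycLevel p k r) ℚ}
    {c d a : ℤ} {A : ℕ}
    {z : ∀ (k : ℕ) (r : (cyclotomicLevelsRat p (badPlaces c d A N)).Ideals),
      H1 (tateRep W p) ((cyclotomicLevelsRat p (badPlaces c d A N)).level k r.1)}
    {x : ∀ (k : ℕ) (r : (cyclotomicLevelsRat p (badPlaces c d A N)).Ideals),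
      CyclotomicField (cycLevel p k r.1) ℚ}
    (hbody : ZetaBody W p f ι κ' Λ' c d a A z x) (hne : 2 * c.natAbs * d.natAbs * A * N ≠ 0)
    {y : I.H} (hy : ∀ n : ℕ, I.proj n y = levelToLayer W p hκ hp (badPlaces c d A N) n
      (z (n + 1) (cyclotomicLevelsRat p (badPlaces c d A N)).idealOne))
    {V : WeierstrassCurve ℚ} [V.IsElliptic] (hf : IsNewformOf V f) (hL1 : V.entireLFunction 1 ≠ 0)
    (hκ' : κ' ≠ 0) (hA : 0 < A) (d' : ℤ) (hcd : Int.gcd (c * d) A = 1) (hdd' : d * d' ≡ 1 [ZMOD (A : ℤ)])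
    (hR : cuspFactor f true (fun _ ↦ 1) c d a A d' ≠ 0) :
    Finite (endInvariants (W.conjFineSelmerInfty κ γ - 1)) ∧
      Finite (integralH1 (tateRep W p) p (κ.layerSubgroup 0) ⧸
        Submodule.span ℤ_[p] {(⟨I.proj 0 y, I.proj_mem 0 y⟩ : integralH1 (tateRep W p) p (κ.layerSubgroup 0))}) ∧
      Nat.card (endInvariants (W.conjFineSelmerInfty κ γ - 1)) ∣
        Nat.card (integralH1 (tateRep W p) p (κ.layerSubgroup 0) ⧸
          Submodule.span ℤ_[p] {(⟨I.proj 0 y, I.proj_mem 0 y⟩ :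
            integralH1 (tateRep W p) p (κ.layerSubgroup 0))}) := by
  obtain ⟨J, e, he, -⟩ := hX W p κ γ hγ v hp hκ hv hfin I
  exact natCard_fineSelmer_invariants_dvd_index_of_embedding W p h134 hSerre hLim hFW hp hκ hγ hCM hred I J
    (W.fineSelmerDualData κ hγ) e he y (isEulerSystemClass_of_zetaBody W p hκ hp I hbody hne hy)
    (MemberIndexOfValue.not_isOfFinAddOrder_proj_zero_of_zetaBody hκ hp hbody hκ' hf hL1 hA d' hcd hdd' hR hy)

end Exists

end Summit.BirchSwinnertonDyer.BirchSwinnertonDyer.Theorems.ReducibleH2DescentCount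

end
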